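import Summits.ResolutionOfSingularities.ResolutionOfSingularities.Theorems.EquisingularLiftEquisingularLiftNatF102MorphismPP
import Summits.ResolutionOfSingularities.ResolutionOfSingularities.Theorems.EquisingularLiftEquisingularLiftNatF102FibreConstants
import Summits.ResolutionOfSingularities.ResolutionOfSingularities.Theorems.EquisingularLiftEquisingularLiftNatF102ChartSurjective
import Summits.ResolutionOfSingularities.ResolutionOfSingularities.Theorems.EquisingularLiftEquisingularLiftNatF102SubsingletonFibres
import Summits.ResolutionOfSingularities.ResolutionOfSingularities.Theorems.EquisingularLiftEquisingularLiftNatF102ClosedFibreOnto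
import Summits.ResolutionOfSingularities.ResolutionOfSingularities.Theorems.EquisingularLiftEquisingularLiftNatF102FlatKernel
import HarnessLib

/-!
# [OURS · L1 W4.5(b) · LINE (T-j)-PROOF · BRICK S5] The morphism `φ : C → ℙ¹_O` — ∃-assembly

Setting of res-L1-w45b-lead-2's F-102 skeleton (v3, binders verbatim): `f : C → Spec O` proper over a DVR, a model square
`(i, t)` over `θ : O ↠ k`, `e : C_k ≅ ℙ¹_{k'}`, two disjoint sections `s₀ ∋ i(e⁻¹ y₀)`, `s₁ ∋ i(e⁻¹ y₁)`.  GIVEN BRICK B4's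
coordinate functions on `W₀ = C ∖ s₀`, `W₁ = C ∖ s₁` (hypotheses `hmul`, `hgen₀`, `hgen₁`, B4's conclusion verbatim with `W_j`
for `sectionCompl s_j`), we assemble BRICK S5 (`exists_morphism_PP_of_coordinates`): a morphism `φ : C → ℙ¹_O` over `Spec O`
(S5a, p575419) with (2) subsingleton fibres over the closed fibre (S5b: p576855, p578600, p579217, p579610, p580175), (3) `i ≫ φ`
onto the closed fibre (res-D-pv-035's p578000) and (4) chart sections hit modulo `𝔪_O` (`chart_sections_mod_varpi`, with the
flat-kernel lemma (K) of res-L1-w45b-stub-4, p580844).  Helper for stmt-ResolutionOfSingularities-20148 (EL♮(3)) via F-102; no new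
definitions.
-/

set_option linter.dupNamespace false

noncomputable section

open CategoryTheory AlgebraicGeometry HomogeneousLocalization TopologicalSpace Opposite IsLocalRing
open MvPolynomial (X C)
open Literature.AlgebraicGeometry.Morphisms Literature.AlgebraicGeometry.Motives Literature.AlgebraicGeometry.Motives.Segre
open Literature.AlgebraicGeometry.Motives.ProjLine
open Summit.ResolutionOfSingularities.ResolutionOfSingularities.Cruxes.EquisingularLiftNat.Sections

universe u

attribute [local instance] MvPolynomial.gradedAlgebra MvPolynomial.algebraMvPolynomial
  Literature.AlgebraicGeometry.Motives.ProjBaseChange.algebraBase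

namespace Summit.ResolutionOfSingularities.ResolutionOfSingularities.Cruxes.EquisingularLiftNat.F102

/-- `appLE V W _` of an isomorphism with `W` its full preimage of `V` is injective. [folklore] -/
theorem appLE_injective_of_isIso {X Y : Scheme.{u}} (g : X ⟶ Y) [IsIso g] (V : Y.Opens) (W : X.Opens)
    (hW : g ⁻¹ᵁ V = W) (h : W ≤ g ⁻¹ᵁ V) : Function.Injective (g.appLE V W h) := by
  subst hW
  rw [Scheme.Hom.appLE_eq_app]
  exact (ConcreteCategory.bijective_of_isIso (g.app V)).1

/-- **BRICK S5, conjunct (4) on one chart: sections over `φ⁻¹ D₊(X_j)` are hit by `Γ(ℙ¹_O, D₊(X_j))` modulo `𝔪_O`.**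
With the chart map of `e⁻¹ ≫ i ≫ φ` onto `Γ(ℙ¹_{k'}, D₊(x_j))` surjective (BRICK S5b (β), from `hrange`, `htU`, `hconst`) and
the flat-kernel hypothesis `hK` on `U = φ⁻¹ D₊(X_j)`: every `b ∈ Γ(C, φ⁻¹ W)`, `W = D₊(X_j)`, is `φ^*(a) + ϖ · c`. [OURS] -/
theorem chart_sections_mod_varpi (O : Type) [CommRing O] [IsLocalRing O] (k : Type) [Field k] (θ : O →+* k)
    (hθ : Function.Surjective θ) {C Ck : Scheme.{0}} (f : C ⟶ Spec (.of O)) (i : Ck ⟶ C) (t : Ck ⟶ Spec (.of k))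
    (hsq : IsPullback i t f (Spec.map (CommRingCat.ofHom θ))) (k' : Type) [Field k'] (e : Ck ≅ ProjCech.PP k' 1)
    (φ : C ⟶ ProjCech.PP O 1) (j : Fin 2) (U : C.Opens) (hUφ : φ ⁻¹ᵁ Proj.basicOpen (grading (Fin 2) O) (X j) = U)
    (tU : Γ(C, U))
    (hrange : (φ.appLE (Proj.basicOpen (grading (Fin 2) O) (X j)) U (le_of_eq hUφ.symm)).hom.range =
      Subring.closure (Set.range ((C.presheaf.map (homOfLE (le_top : U ≤ ⊤)).op).hom.comp (pull f)) ∪ {tU}))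
    (hpre : (e.inv ≫ i) ⁻¹ᵁ U = Proj.basicOpen (A k') (X j)) (c : k') (hc : c ≠ 0)
    (htU : (e.inv ≫ i).appLE U (Proj.basicOpen (A k') (X j)) hpre.ge tU =
      Proj.awayToSection (A k') (X j) (Segre.cst k' (X j) c) * sec k' j)
    (hconst : ∀ c' : k', ∃ κ : k, (e.inv ≫ t).appLE ⊤ (Proj.basicOpen (A k') (X j)) le_top
      ((Scheme.ΓSpecIso (.of k)).inv κ) = Proj.awayToSection (A k') (X j) (Segre.cst k' (X j) c'))
    (hK : ∀ b : Γ(C, U), i.appLE U (i ⁻¹ᵁ U) le_rfl b = 0 → ∃ (ϖ : O) (c : Γ(C, U)), ϖ ∈ maximalIdeal O ∧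
      b = C.presheaf.map (homOfLE (le_top : U ≤ ⊤)).op (f.appTop ((Scheme.ΓSpecIso (.of O)).inv ϖ)) * c)
    (W : (ProjCech.PP O 1).Opens) (hW : W = Proj.basicOpen (grading (Fin 2) O) (X j)) (b : Γ(C, φ ⁻¹ᵁ W)) :
    ∃ (a : Γ(ProjCech.PP O 1, W)) (ϖ : O) (c : Γ(C, φ ⁻¹ᵁ W)), ϖ ∈ maximalIdeal O ∧
      b = φ.app W a + (f.app ⊤ ((Scheme.ΓSpecIso (.of O)).inv ϖ) |_ (φ ⁻¹ᵁ W)) * c := by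
  subst hW
  subst hUφ
  have hle : Proj.basicOpen (A k') (X j) ≤ (e.inv ≫ i ≫ φ) ⁻¹ᵁ Proj.basicOpen (grading (Fin 2) O) (X j) := hpre.ge
  have hsurj := chart_appLE_surjective O k θ hθ f i t hsq k' e φ j _ rfl tU hrange hpre.ge c hc htU hconst hle
  obtain ⟨a, ha⟩ := hsurj ((e.inv ≫ i).appLE _ (Proj.basicOpen (A k') (X j)) hpre.ge b)
  have key : (e.inv ≫ i ≫ φ).appLE _ _ hle a =
      (e.inv ≫ i).appLE _ (Proj.basicOpen (A k') (X j)) hpre.ge (φ.app (Proj.basicOpen (grading (Fin 2) O) (X j)) a) := by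
    rw [Scheme.Hom.app_eq_appLE, ← CommRingCat.comp_apply (φ.appLE _ _ _), Scheme.Hom.appLE_comp_appLE]
    rfl
  have h1 : (e.inv ≫ i).appLE _ (Proj.basicOpen (A k') (X j)) hpre.ge
      (b - φ.app (Proj.basicOpen (grading (Fin 2) O) (X j)) a) = 0 := by
    rw [map_sub, sub_eq_zero, ← key, ha]
  rw [Scheme.Hom.comp_appLE, CommRingCat.comp_apply] at h1
  have h2 : i.app _ (b - φ.app (Proj.basicOpen (grading (Fin 2) O) (X j)) a) = 0 :=
    appLE_injective_of_isIso e.inv (i ⁻¹ᵁ (φ ⁻¹ᵁ Proj.basicOpen (grading (Fin 2) O) (X j))) _ hpre _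
      (h1.trans (map_zero _).symm)
  rw [Scheme.Hom.app_eq_appLE] at h2
  obtain ⟨ϖ, c', hϖ, hbc⟩ := hK _ h2
  exact ⟨a, ϖ, c', hϖ, sub_eq_iff_eq_add'.mp hbc⟩

/-- **BRICK S5 (∃-assembly from B4's coordinates).** `f` proper and flat; the flat-kernel lemma (K) is stub-4's
`exists_eq_varpi_mul_of_appLE_eq_zero` (p580844). [OURS] -/
theorem exists_morphism_PP_of_coordinates (O : Type) [CommRing O] [IsDomain O] [IsDiscreteValuationRing O]
    (k : Type) [Field k] (θ : O →+* k) (C : Scheme.{0}) (f : C ⟶ Spec (.of O)) [IsProper f] [Flat f]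
    (Ck : Scheme.{0}) (i : Ck ⟶ C) (t : Ck ⟶ Spec (.of k)) (hθ : Function.Surjective θ)
    (hsq : IsPullback i t f (Spec.map (CommRingCat.ofHom θ))) (k' : Type) [Field k'] (e : Ck ≅ ProjCech.PP k' 1)
    (s₀ s₁ : Spec (.of O) ⟶ C) (hs₀ : s₀ ≫ f = 𝟙 _) (hs₁ : s₁ ≫ f = 𝟙 _)
    (hz₀ : s₀.base (closedPoint O) = i.base (e.inv.base (ProjLine.y k' 0)))
    (hz₁ : s₁.base (closedPoint O) = i.base (e.inv.base (ProjLine.y k' 1)))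
    (hdisj : Disjoint (Set.range s₀.base) (Set.range s₁.base))
    (W₀ W₁ : C.Opens) (hW₀c : (W₀ : Set C) = (Set.range s₀.base)ᶜ) (hW₁c : (W₁ : Set C) = (Set.range s₁.base)ᶜ)
    (t₀ : Γ(C, W₀)) (t₁ : Γ(C, W₁))
    (hmul : C.presheaf.map (homOfLE (inf_le_left : W₀ ⊓ W₁ ≤ W₀)).op t₀ *
      C.presheaf.map (homOfLE (inf_le_right : W₀ ⊓ W₁ ≤ W₁)).op t₁ = 1)
    (hgen₀ : ∀ V : C.affineOpens, ∀ hV : (V : C.Opens) ≤ W₀,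
      s₁.ker.ideal V = Ideal.span {C.presheaf.map (homOfLE hV).op t₀})
    (hgen₁ : ∀ V : C.affineOpens, ∀ hV : (V : C.Opens) ≤ W₁,
      s₀.ker.ideal V = Ideal.span {C.presheaf.map (homOfLE hV).op t₁}) :
    ∃ φ : C ⟶ ProjCech.PP O 1, φ ≫ ProjCech.toSpec O 1 = f ∧
      (∀ y : ProjCech.PP O 1, ProjCech.toSpec O 1 y = closedPoint O → (φ.base ⁻¹' {y}).Subsingleton) ∧
      Set.range (i ≫ φ).base = (ProjCech.toSpec O 1).base ⁻¹' {closedPoint O} ∧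
      (∀ j : Fin 2, ∀ b : Γ(C, φ ⁻¹ᵁ ProjCech.Dplus O 1 {j}), ∃ (a : Γ(ProjCech.PP O 1, ProjCech.Dplus O 1 {j}))
          (ϖ : O) (c : Γ(C, φ ⁻¹ᵁ ProjCech.Dplus O 1 {j})), ϖ ∈ maximalIdeal O ∧
          b = φ.app (ProjCech.Dplus O 1 {j}) a + (f.app ⊤ ((Scheme.ΓSpecIso (.of O)).inv ϖ) |_ _) * c) := by
  haveI : IsClosedImmersion (s₀ ≫ f) := by rw [hs₀]; infer_instance
  haveI : IsClosedImmersion s₀ := IsClosedImmersion.of_comp s₀ f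
  haveI : IsClosedImmersion (s₁ ≫ f) := by rw [hs₁]; infer_instance
  haveI : IsClosedImmersion s₁ := IsClosedImmersion.of_comp s₁ f
  have hK : ∀ (U : C.Opens) (b : Γ(C, U)), i.appLE U (i ⁻¹ᵁ U) le_rfl b = 0 →
      ∃ (ϖ : O) (c : Γ(C, U)), ϖ ∈ maximalIdeal O ∧
        b = C.presheaf.map (homOfLE (le_top : U ≤ ⊤)).op (f.appTop ((Scheme.ΓSpecIso (.of O)).inv ϖ)) * c :=
    fun U b hb => exists_eq_varpi_mul_of_appLE_eq_zero O k θ hθ f i t hsq U b hb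
  -- S5a: the morphism, from the coordinate pair on the cover `W₁ ∪ W₀`
  have hcov : W₁ ⊔ W₀ = ⊤ := sup_eq_top_of_compl_of_disjoint hdisj.symm W₁ W₀ hW₁c hW₀c
  have hb₁ : C.basicOpen t₁ = W₁ ⊓ W₀ :=
    basicOpen_eq_inf_of_ker_ideal_eq_span s₀ s₀.isClosedEmbedding.isClosed_range W₁ W₀ hW₀c t₁ hgen₁
  have hb₀' : C.basicOpen t₀ = W₀ ⊓ W₁ :=
    basicOpen_eq_inf_of_ker_ideal_eq_span s₁ s₁.isClosedEmbedding.isClosed_range W₀ W₁ hW₁c t₀ hgen₀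
  have hb₀ : C.basicOpen t₀ = W₁ ⊓ W₀ := by rw [inf_comm]; exact hb₀'
  have hmul' : C.presheaf.map (homOfLE (inf_le_left : W₁ ⊓ W₀ ≤ W₁)).op t₁ *
      C.presheaf.map (homOfLE (inf_le_right : W₁ ⊓ W₀ ≤ W₀)).op t₀ = 1 := by
    have h := congrArg (C.presheaf.map (homOfLE (le_of_eq (inf_comm W₁ W₀) : W₁ ⊓ W₀ ≤ W₀ ⊓ W₁)).op) hmul
    rw [map_mul, map_one, ← CommRingCat.comp_apply, ← CommRingCat.comp_apply, ← Functor.map_comp,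
      ← Functor.map_comp] at h
    rw [mul_comm]
    exact h
  obtain ⟨φ, h₀, h₁, hφ, hr₀, hr₁⟩ := exists_toPP_of_coordinatePair O f W₁ W₀ hcov t₁ t₀ hb₁ hb₀ hmul'
  -- S5b: the special fibre of the coordinates
  obtain ⟨hU0, c₀, hc₀, ht₁⟩ :=
    exists_appLE_eq_cst_mul_sec O k θ hθ f i t hsq k' e 0 s₀ s₁ hs₀ hs₁ hz₀ hz₁ W₁ W₀ hW₁c hW₀c t₁ hb₁ hgen₁
  obtain ⟨hU1, c₁, hc₁, ht₀⟩ :=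
    exists_appLE_eq_cst_mul_sec O k θ hθ f i t hsq k' e 1 s₁ s₀ hs₁ hs₀ hz₁ hz₀ W₀ W₁ hW₀c hW₁c t₀ hb₀' hgen₀
  have hpre0 : (e.inv ≫ i) ⁻¹ᵁ W₁ = Proj.basicOpen (A k') (X 0) :=
    preimage_inv_comp_eq_basicOpen θ hθ f i t hsq e 0 s₁ hs₁ hz₁ W₁ hW₁c
  have hpre1 : (e.inv ≫ i) ⁻¹ᵁ W₀ = Proj.basicOpen (A k') (X 1) :=
    preimage_inv_comp_eq_basicOpen θ hθ f i t hsq e 1 s₀ hs₀ hz₀ W₀ hW₀c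
  have hpre : ∀ j : Fin 2, (e.inv ≫ i ≫ φ) ⁻¹ᵁ Proj.basicOpen (grading (Fin 2) O) (X j) =
      Proj.basicOpen (A k') (X j) := by
    intro j
    match j with
    | 0 =>
      change (e.inv ≫ i) ⁻¹ᵁ (φ ⁻¹ᵁ Proj.basicOpen (grading (Fin 2) O) (X 0)) = _
      rw [h₀, hpre0]
    | 1 =>
      change (e.inv ≫ i) ⁻¹ᵁ (φ ⁻¹ᵁ Proj.basicOpen (grading (Fin 2) O) (X 1)) = _
      rw [h₁, hpre1]
  -- (α′): constants; (β): chart maps onto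
  have hconst0 := fun c' => exists_const_eq_awayToSection_cst O k θ hθ f i t hsq k' e s₀ hs₀ 0 hz₀ c'
  have hconst1 := fun c' => exists_const_eq_awayToSection_cst O k θ hθ f i t hsq k' e s₁ hs₁ 1 hz₁ c'
  have hsurj : ∀ j : Fin 2, Function.Surjective ((e.inv ≫ i ≫ φ).appLE (Proj.basicOpen (grading (Fin 2) O) (X j))
      (Proj.basicOpen (A k') (X j)) (hpre j).ge) := by
    intro j
    match j with
    | 0 => exact chart_appLE_surjective O k θ hθ f i t hsq k' e φ 0 W₁ h₀ t₁ hr₀ hU0 c₀ hc₀ ht₁ hconst0 _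
    | 1 => exact chart_appLE_surjective O k θ hθ f i t hsq k' e φ 1 W₀ h₁ t₀ hr₁ hU1 c₁ hc₁ ht₀ hconst1 _
  -- (2), (3)
  have hinj := subsingleton_fibres_of_chart_surjective O k θ hθ f i t hsq k' e φ hφ hpre hsurj
  have honto := range_comp_eq_closedFibre_of_subsingleton_fibres O k θ C f Ck i t hθ hsq ⟨k', inferInstance, ⟨e⟩⟩ φ hφ hinj
  refine ⟨φ, hφ, hinj, honto, ?_⟩
  -- (4)
  intro j b
  have hD : ProjCech.Dplus O 1 {j} = Proj.basicOpen (grading (Fin 2) O) (X j) := by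
    change Proj.basicOpen _ (Literature.Algebra.Homology.LaurentCech.Xs O {j}) = _
    rw [Literature.Algebra.Homology.LaurentCech.Xs, Finset.prod_singleton]
  match j, b, hD with
  | 0, b, hD => exact chart_sections_mod_varpi O k θ hθ f i t hsq k' e φ 0 W₁ h₀ t₁ hr₀ hpre0 c₀ hc₀ ht₁ hconst0 (hK W₁) _ hD b
  | 1, b, hD => exact chart_sections_mod_varpi O k θ hθ f i t hsq k' e φ 1 W₀ h₁ t₀ hr₁ hpre1 c₁ hc₁ ht₀ hconst1 (hK W₀) _ hD b

end Summit.ResolutionOfSingularities.ResolutionOfSingularities.Cruxes.EquisingularLiftNat.F102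

end
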